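import Summits.BirchSwinnertonDyer.BirchSwinnertonDyer.Theorems.ResidualThetaTransportAtTwoSignedMuVanishingAtTwoPlusMultOneOldFamilyPrime
import HarnessLib

/-!
# Route `ResidualThetaTransportAtTwo`, crux Kμ⁺ `SignedMuVanishingAtTwoPlus` (stmt-BirchSwinnertonDyer-20689), line
# `birth`, stub `stub_flatMuZeroAtTwo`: the OLD-FAMILY ENGINE — `U_p`-bookkeeping mod `2` from an identity
# `T_p H = a·H + 2·K`, and the three `T_p`-rules on the old forms `D_t = degeneracyMap0 N₀ N t 2 g`

Cell `bsd-wall`, width seat `bsd-wall-rtt-p4-w2` (g4). THEOREMS ONLY; helper `--supports` the crux; closes nothing. BSD is not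
proved by this. Purpose: make the hypothesis `hbad` of `…OldClassCongruence.flatAtTwo_of_multOne` / `…MultOneHabitat.flatAtTwo_of_namedFacts`
MECHANICAL for any level pattern `N_W = N₀ · M`: one shows `T_p H − (a_p(f)) H = 2K` with `K` an integral combination of old forms.

## What is proved
* `hbad_of_two_smul` — if `T_p H = a • H + 2 • K` where `K` has doubled real `g`-periods in `ℤ·Ω⁺_g/2` ("integral"), then for
  `{∞,σ∞} = T_p^∨{∞,γ∞}` the doubled real periods of `H` satisfy `m_σ ≡ a · m_γ (mod 2)`.
* integrality is preserved by `+`, `ℤ •`, and holds for every `D_t g` (`cuspSymbol_degeneracyMap0`): `integral_add`, `integral_zsmul`,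
  `integral_degeneracyMap0`, `integral_zero`.
* the `T_p`-RULES on `D_t = degeneracyMap0 N₀ N t 2 g` (`g` a normalised newform of level `N₀`, weight `2`, `D_t = t · ι_t g`):
  `heckeT_D_of_not_dvd` (`p ∣ N`, `p ∤ N₀ t`: `T_p D_t = a_p(g) D_t − D_{tp}`), `heckeT_D_of_dvd` (`T_p D_{tp} = p D_t`),
  `heckeT_D_of_dvd_level` (`p ∣ N₀`, `p ∤ t`: `T_p D_t = a_p(g) D_t`), `heckeT_D_of_not_dvd_level'` (`p ∤ N`: `T_p D_t = a_p(g) D_t`).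

References: [AtkinLehner1970] Lemma 15; [DiamondShurman2005] Prop. 5.2.2, §5.7, Prop. 5.8.5; [CremonaAlgorithms1997] §2.4;
[EmertonPollackWeston2006] §4.4.
-/

set_option autoImplicit false
set_option linter.dupNamespace false

noncomputable section

open scoped Classical MatrixGroups ModularForm

open CongruenceSubgroup WeierstrassCurve Literature.NumberTheory.EllipticCurves
  Literature.NumberTheory.EllipticCurves.ModularForms Literature.NumberTheory.EllipticCurves.Rank1Residual

namespace Summit.BirchSwinnertonDyer.BirchSwinnertonDyer.Theorems.SignedMuAtTwo

namespace MultOneDictionary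

variable {N₀ N : ℕ} [NeZero N₀] [NeZero N]

/-! ## §1. Bookkeeping mod 2 from `T_p H = a·H + 2·K` -/

omit [NeZero N₀] in
/-- **`U_p`-bookkeeping mod `2` from `T_p H = a·H + 2·K`.** Let `Ω = Ω⁺_g ≠ 0`, `H, K ∈ S₂(Γ₀(N))` with `K` INTEGRAL (every
`2 re{∞,γ∞}_K/Ω ∈ ℤ`), and `T_p H = a·H + 2·K` (`a ∈ ℤ`). If `{∞,σ∞} = T_p^∨{∞,γ∞}` and `2re{∞,σ∞}_H = m_σ Ω`,
`2re{∞,γ∞}_H = m_γ Ω`, then `m_σ ≡ a·m_γ (mod 2)` — the clause `hbad` of `…OldClassCongruence` at `p`, granted `a ≡ a_p(f)`.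
[cite: CremonaAlgorithms1997, §2.4] [cite: EmertonPollackWeston2006, §4.4] -/
theorem hbad_of_two_smul (g : CuspForm (Gamma0 N₀) 2) (hΩg : plusPeriod g ≠ 0) (H K : CuspForm (Gamma0 N) 2)
    (hK : ∀ γ : Gamma0 N, ∃ m : ℤ, (cuspSymbol K γ).re = m * (plusPeriod g / 2))
    {p : ℕ} [NeZero p] (a : ℤ) (hT : heckeT (Gamma0 N) 2 p H = (a : ℂ) • H + (2 : ℂ) • K)
    (γ σ : Gamma0 N) (hσ : periodFunctional N σ = (heckeT (Gamma0 N) 2 p).dualMap (periodFunctional N γ))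
    (mσ mγ : ℤ) (hmσ : (cuspSymbol H σ).re = mσ * (plusPeriod g / 2)) (hmγ : (cuspSymbol H γ).re = mγ * (plusPeriod g / 2)) :
    (mσ : ZMod 2) = (a : ZMod 2) * (mγ : ZMod 2) := by
  obtain ⟨k, hk⟩ := hK γ
  have hσH : cuspSymbol H σ = (a : ℂ) * cuspSymbol H γ + 2 * cuspSymbol K γ := by
    have := congrArg (fun φ : Module.Dual ℂ (CuspForm (Gamma0 N) 2) ↦ φ H) hσ
    simp only [periodFunctional_apply, LinearMap.dualMap_apply] at this
    rw [this, hT, ← periodFunctional_apply, map_add, map_smul, map_smul, periodFunctional_apply, periodFunctional_apply,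
      smul_eq_mul, smul_eq_mul]
  have h2 : mσ = a * mγ + 2 * k := by
    apply int_eq_of_mul_plusPeriod_half_eq g hΩg
    have := congrArg Complex.re hσH
    rw [show ((a : ℂ)) = (((a : ℤ) : ℝ) : ℂ) by norm_cast, show (2 : ℂ) = ((2 : ℝ) : ℂ) by norm_cast, Complex.add_re,
      Complex.re_ofReal_mul, Complex.re_ofReal_mul, hmσ, hmγ, hk] at this
    rw [this]; push_cast; ring
  rw [h2]; push_cast
  rw [show (2 : ZMod 2) = 0 from rfl, zero_mul, add_zero]

/-! ## §2. Integral forms -/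

omit [NeZero N₀] in
/-- `0` is integral. [folklore] -/
theorem integral_zero (g : CuspForm (Gamma0 N₀) 2) :
    ∀ γ : Gamma0 N, ∃ m : ℤ, (cuspSymbol (0 : CuspForm (Gamma0 N) 2) γ).re = m * (plusPeriod g / 2) :=
  fun γ ↦ ⟨0, by rw [← periodFunctional_apply, map_zero]; simp⟩

omit [NeZero N₀] in
/-- Integral forms are stable under addition. [folklore] -/
theorem integral_add (g : CuspForm (Gamma0 N₀) 2) {K₁ K₂ : CuspForm (Gamma0 N) 2}
    (h₁ : ∀ γ : Gamma0 N, ∃ m : ℤ, (cuspSymbol K₁ γ).re = m * (plusPeriod g / 2))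
    (h₂ : ∀ γ : Gamma0 N, ∃ m : ℤ, (cuspSymbol K₂ γ).re = m * (plusPeriod g / 2)) :
    ∀ γ : Gamma0 N, ∃ m : ℤ, (cuspSymbol (K₁ + K₂) γ).re = m * (plusPeriod g / 2) := by
  intro γ
  obtain ⟨m₁, hm₁⟩ := h₁ γ
  obtain ⟨m₂, hm₂⟩ := h₂ γ
  exact ⟨m₁ + m₂, by rw [cuspSymbol_add, Complex.add_re, hm₁, hm₂]; push_cast; ring⟩

omit [NeZero N₀] [NeZero N] in
/-- Integral forms are stable under integer scalars. [folklore] -/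
theorem integral_zsmul (g : CuspForm (Gamma0 N₀) 2) {K : CuspForm (Gamma0 N) 2}
    (h : ∀ γ : Gamma0 N, ∃ m : ℤ, (cuspSymbol K γ).re = m * (plusPeriod g / 2)) (c : ℤ) :
    ∀ γ : Gamma0 N, ∃ m : ℤ, (cuspSymbol ((c : ℂ) • K) γ).re = m * (plusPeriod g / 2) := by
  intro γ
  obtain ⟨m, hm⟩ := h γ
  refine ⟨c * m, ?_⟩
  rw [cuspSymbol_smul, show ((c : ℂ)) = (((c : ℤ) : ℝ) : ℂ) by norm_cast, Complex.re_ofReal_mul, hm]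
  push_cast; ring

/-- The old forms `D_t g = degeneracyMap0 N₀ N t 2 g` (`N₀ t ∣ N`) are integral: `{∞,γ∞}_{D_t g} = {∞,δ_tγ∞}_g`.
[cite: CremonaAlgorithms1997, §2.4 (2.4.1)–(2.4.2)] -/
theorem integral_degeneracyMap0 (g : CuspForm (Gamma0 N₀) 2) (hΩg : plusPeriod g ≠ 0) {t : ℕ} [NeZero t] (h : N₀ * t ∣ N) :
    ∀ γ : Gamma0 N, ∃ m : ℤ, (cuspSymbol (degeneracyMap0 N₀ N t 2 g) γ).re = m * (plusPeriod g / 2) := fun γ ↦ by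
  rw [cuspSymbol_degeneracyMap0 h]
  exact exists_int_re_cuspSymbol_eq g hΩg _

/-! ## §3. The `T_p`-rules on `D_t = degeneracyMap0 N₀ N t 2 g` -/

/-- `degeneracyMap0` does not depend on how `t` is written. [folklore] -/
theorem degeneracyMap0_congr {d₁ d₂ : ℕ} [NeZero d₁] [NeZero d₂] (e : d₁ = d₂) (g : CuspForm (Gamma0 N₀) 2) :
    degeneracyMap0 N₀ N d₁ 2 g = degeneracyMap0 N₀ N d₂ 2 g := by
  subst e; rfl

/-- **`T_p D_t = a_p(g) D_t − D_{tp}`** for a prime `p ∣ N`, `p ∤ N₀`, `p ∤ t`, `N₀ t p ∣ N` (`g` a normalised newform of level `N₀`).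
[cite: DiamondShurman2005, Prop. 5.2.2 (a), §5.7, Prop. 5.8.5] [cite: AtkinLehner1970, Lemma 15] -/
theorem heckeT_D_of_not_dvd {g : CuspForm (Gamma0 N₀) 2} (hg : IsNewform0 g) {p : ℕ} (hp : p.Prime) (hpN : p ∣ N)
    (hpN₀ : ¬ p ∣ N₀) {t tp : ℕ} [NeZero t] [NeZero tp] (hpt : ¬ p ∣ t) (htp : tp = t * p) (h : N₀ * t ∣ N) (h' : N₀ * tp ∣ N) :
    (haveI : NeZero p := ⟨hp.ne_zero⟩; heckeT (Gamma0 N) 2 p (degeneracyMap0 N₀ N t 2 g)) =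
      cuspCoeff g p • degeneracyMap0 N₀ N t 2 g - degeneracyMap0 N₀ N tp 2 g := by
  haveI : NeZero p := ⟨hp.ne_zero⟩
  haveI : NeZero (t * p) := ⟨by rw [← htp]; exact NeZero.ne tp⟩
  have h'' : N₀ * (t * p) ∣ N := by rw [← htp]; exact h'
  rw [degeneracyMap0_two_eq h, degeneracyMap0_two_eq h', map_smul,
    heckeT_iota_of_not_dvd_of_not_dvd_level hp hpN hpN₀ hpt h h'' hg, show ((2 : ℤ) - 1) = 1 by norm_num, zpow_one,
    iota_congr htp h' h'', smul_sub, smul_comm ((t : ℕ) : ℂ) (cuspCoeff g p), smul_smul, htp, Nat.cast_mul]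
  rw [smul_smul]

/-- **`T_p D_{tp} = p · D_t`** for a prime `p ∣ N` and `N₀ t p ∣ N` (any `g`). [cite: DiamondShurman2005, Prop. 5.2.2 (a) and §5.7]
[cite: AtkinLehner1970, Lemma 15] -/
theorem heckeT_D_of_dvd (g : CuspForm (Gamma0 N₀) 2) {p : ℕ} (hp : p.Prime) (hpN : p ∣ N) {t tp : ℕ} [NeZero t] [NeZero tp]
    (htp : tp = t * p) (h : N₀ * t ∣ N) (h' : N₀ * tp ∣ N) :
    (haveI : NeZero p := ⟨hp.ne_zero⟩; heckeT (Gamma0 N) 2 p (degeneracyMap0 N₀ N tp 2 g)) =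
      (p : ℂ) • degeneracyMap0 N₀ N t 2 g := by
  haveI : NeZero p := ⟨hp.ne_zero⟩
  haveI : NeZero (t * p) := ⟨by rw [← htp]; exact NeZero.ne tp⟩
  have h'' : N₀ * (t * p) ∣ N := by rw [← htp]; exact h'
  rw [degeneracyMap0_two_eq h, degeneracyMap0_two_eq h', map_smul, iota_congr htp h' h'',
    heckeT_iota_of_dvd hp hpN h'' h g, smul_smul, htp, Nat.cast_mul, mul_comm (p : ℂ)]

/-- **`T_p D_t = a_p(g) D_t`** for a prime `p ∣ N₀` with `p ∤ t` (`g` a normalised newform of level `N₀`, `N₀ t ∣ N`).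
[cite: DiamondShurman2005, Prop. 5.2.2 (a), Prop. 5.8.5 and §5.7] -/
theorem heckeT_D_of_dvd_level {g : CuspForm (Gamma0 N₀) 2} (hg : IsNewform0 g) {p : ℕ} (hp : p.Prime) (hpN₀ : p ∣ N₀)
    {t : ℕ} [NeZero t] (hpt : ¬ p ∣ t) (h : N₀ * t ∣ N) :
    (haveI : NeZero p := ⟨hp.ne_zero⟩; heckeT (Gamma0 N) 2 p (degeneracyMap0 N₀ N t 2 g)) = cuspCoeff g p • degeneracyMap0 N₀ N t 2 g := by
  haveI : NeZero p := ⟨hp.ne_zero⟩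
  have hpN : p ∣ N := hpN₀.trans ((dvd_mul_right N₀ t).trans h)
  rw [degeneracyMap0_two_eq h, map_smul, heckeT_iota_of_not_dvd_of_dvd_level hp hpN hpN₀ hpt h hg,
    smul_comm ((t : ℕ) : ℂ) (cuspCoeff g p)]

/-- **`T_p D_t = a_p(g) D_t`** for a prime `p ∤ N` (`g` a newform of level `N₀`, `N₀ t ∣ N`; the tree's
`heckeT_degeneracyMap0_of_isNewform0`, restated in this file's shape). [cite: AtkinLehner1970, Thm. 3] -/
theorem heckeT_D_of_not_dvd_level' {g : CuspForm (Gamma0 N₀) 2} (hg : IsNewform0 g) {p : ℕ} (hp : p.Prime) (hpN : ¬ p ∣ N)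
    {t : ℕ} [NeZero t] (h : N₀ * t ∣ N) :
    (haveI : NeZero p := ⟨hp.ne_zero⟩; heckeT (Gamma0 N) 2 p (degeneracyMap0 N₀ N t 2 g)) = cuspCoeff g p • degeneracyMap0 N₀ N t 2 g :=
  heckeT_degeneracyMap0_of_isNewform0 h hg hp hpN

end MultOneDictionary

end Summit.BirchSwinnertonDyer.BirchSwinnertonDyer.Theorems.SignedMuAtTwo

end
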